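import Mathlib
import Summits.ValiantsHypothesis.ValiantsHypothesis.Theorems.FifoMatchingNNLinearDegreeCofactorHardShedWordGateBounds
import HarnessLib

/-!
# Crux `NNLinearDegreeCofactorHard` (stmt-ValiantsHypothesis-23918), line `internal_cofactor`, stub S2b (ii):
# μ* = shedWord — the ARRIVAL attribution (`P′ ≤ T + G + 1`) and the PRICING of the respecting band words

For a band bit string `y` (`|fairWalk| < w < F₀` on `[H, E]`) whose balanced word respects `S`:

* `exists_isTest_between` — **between two gates `j < j'` with a push at `j` (a FAILED gate) lies a test coin**: either the
  front is unchanged at `j'` (then `j'` is a second good exit of the same front period — `no_two_goodExits`), or the front was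
  popped at `τ ∈ (j, j')`, the R-items of its chain were shed at the next non-defect positions (`chain`) with the front's colour,
  and `no_two_goodExits` applies to `τ`;  hence `card_failedGates_le` — **`F ≤ T + 1`** (`card_le_card_add_one_of_between`);
* `card_sBoundariesPopped_le` — **`P′ ≤ T + G + 1`**: every S-boundary item `k` popped before `E` with an S-item below it owns
  the coin `φ k` = the pop time `τ` of its S-predecessor if that is a gate (then a PASSED gate: the bit is `D`), and otherwise
  the `(k - k₀)`-th non-defect position after `τ`, where `k` reaches the front, which is then a TEST; `φ` is strictly increasing.

With `CondProbBits.card_mul_le_of_passages_succ` this prices the respecting band words: `card_resp_mul_le_of_gates`.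
Honest framing: bookkeeping; nothing here proves S2b, the crux or VP ≠ VNP (not proved).  No new definitions. [folklore]
-/

noncomputable section

-- Sub = Summit single-conjunct layout: the duplicated namespace component is mandated by the tree.
set_option linter.dupNamespace false

namespace Summit.ValiantsHypothesis.ValiantsHypothesis.Theorems.FifoMatching.NNLinearDegreeCofactorHard.ShedWord

open Finset Literature.Computability.AlgebraicComplexity
open Summit.ValiantsHypothesis.ValiantsHypothesis.Theorems.FifoMatching.NNMonotoneHard
open Summit.ValiantsHypothesis.ValiantsHypothesis.Theorems.FifoMatching.NNLinearDegreeCofactorHard.QueueHistory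
open Summit.ValiantsHypothesis.ValiantsHypothesis.Theorems.FifoMatching.NNLinearDegreeCofactorHard.CondProbBits

variable {N : ℕ} (R : Finset (Fin N)) (H E : ℕ) (y : Fin N → Bool) (S : Finset (Fin N))

/-! ### S-boundary arrivals own passed gates or tests -/

/-- The S-predecessor bookkeeping of `QueueHistory.sBd`, for `isS = !isRItem`. [folklore] -/
theorem findGreatest_spec_of_exists {k : ℕ} (hex : ∃ i, i < k ∧ isRItem R H E y i = false) :
    Nat.findGreatest (fun n => (!isRItem R H E y n) = true) (k - 1) < k ∧
    isRItem R H E y (Nat.findGreatest (fun n => (!isRItem R H E y n) = true) (k - 1)) = false ∧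
    ∀ i, Nat.findGreatest (fun n => (!isRItem R H E y n) = true) (k - 1) < i → i < k → isRItem R H E y i = true := by
  obtain ⟨i, hik, hi⟩ := hex
  refine ⟨lt_of_le_of_lt (Nat.findGreatest_le _) (by omega), ?_, fun i' h1 h2 => ?_⟩
  · have := Nat.findGreatest_spec (P := fun n => (!isRItem R H E y n) = true) (show i ≤ k - 1 by omega) (by simp [hi])
    simpa using this
  · have := Nat.findGreatest_is_greatest (P := fun n => (!isRItem R H E y n) = true) h1 (by omega)
    simpa using this

/-- **`P′ ≤ T + G + 1`**: the S-boundaries among the items popped before `E` number at most the test coins plus the passed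
gates plus one. [folklore] -/
theorem card_sBoundariesPopped_le (hbal : (closerSet (shedWord R H E y)).card = (openerSet (shedWord R H E y)).card)
    (hresp : ∀ i, i ∈ S ↔ fifo (shedWord R H E y) hbal i ∈ S) (hEN : E ≤ N) {w : ℕ} (hwF : w < freeCount R 0 H)
    (hband : ∀ s, H ≤ s → s ≤ E → |fairWalk R H E y s| < w) :
    sBoundariesPopped R H E y S ≤ ((range N).filter fun j => kind R H E S j y = 1).card +
      ((range N).filter fun j => kind R H E S j y = 2 ∧ bitAt y j = desig R H E S j y).card + 1 := by
  classical
  have hw : w ≤ freeCount R 0 H := hwF.le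
  unfold sBoundariesPopped sBd
  set B := (Ioo 0 (pops (shedPrefix R H E y E))).filter fun k => (!isRItem R H E y k) = true ∧
    posColour S (openTime R H E y k) ≠
      posColour S (openTime R H E y (Nat.findGreatest (fun n => (!isRItem R H E y n) = true) (k - 1))) with hB
  set B₁ := B.filter fun k => ∃ i, i < k ∧ isRItem R H E y i = false with hB₁
  set B₀ := B.filter fun k => ¬ ∃ i, i < k ∧ isRItem R H E y i = false with hB₀
  have hsplit : B.card = B₁.card + B₀.card := by
    rw [hB₁, hB₀]; exact (card_filter_add_card_filter_not _).symm
  -- `B₀` has at most one element: the least S-item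
  have hB₀ : B₀.card ≤ 1 := by
    rw [card_le_one]
    intro a ha b hb
    rw [hB₀, mem_filter, hB, mem_filter] at ha hb
    by_contra hab
    rcases Nat.lt_or_gt_of_ne hab with h | h
    · exact hb.2 ⟨a, h, by simpa using ha.1.2.1⟩
    · exact ha.2 ⟨b, h, by simpa using hb.1.2.1⟩
  -- abbreviations for an arrival `k`: its S-predecessor `k₀ k`, the pop time `τ k` of `k₀ k`, the coin `φ k`
  set k₀ : ℕ → ℕ := fun k => Nat.findGreatest (fun n => (!isRItem R H E y n) = true) (k - 1) with hk₀
  set τ : ℕ → ℕ := fun k => closeTime R H E y hbal (k₀ k) with hτ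
  set φ : ℕ → ℕ := fun k => if isGate R H E y S (τ k) = true then τ k else freeIter R (τ k) (k - k₀ k) with hφ
  have hpopsE : pops (shedPrefix R H E y E) ≤ (openerSet (shedWord R H E y)).card :=
    (pops_le_pushes R H E y E).trans (pushes_le_card_openerSet R H E y hEN)
  -- the specification of `φ k`
  have hspec : ∀ k ∈ B₁, ((kind R H E S (φ k) y = 1) ∨
      (kind R H E S (φ k) y = 2 ∧ bitAt y (φ k) = desig R H E S (φ k) y)) ∧
      τ k ≤ φ k ∧ φ k < closeTime R H E y hbal k := by
    intro k hk
    rw [hB₁, mem_filter, hB, mem_filter, mem_Ioo] at hk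
    obtain ⟨⟨⟨_, hkE⟩, hkS, hcolk⟩, hex⟩ := hk
    have hkS' : isRItem R H E y k = false := by simpa using hkS
    obtain ⟨hk₀k, hk₀S, hbetween⟩ : k₀ k < k ∧ isRItem R H E y (k₀ k) = false ∧
        ∀ i, k₀ k < i → i < k → isRItem R H E y i = true := findGreatest_spec_of_exists R H E y hex
    have hkO : k < (openerSet (shedWord R H E y)).card := lt_of_lt_of_le hkE hpopsE
    have hk₀O : k₀ k < (openerSet (shedWord R H E y)).card := hk₀k.trans hkO
    have hpopτ : shedLetter R H E y (τ k) = false := shedLetter_closeTime R H E y hbal hk₀O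
    have hpopsτ : pops (shedPrefix R H E y (τ k)) = k₀ k := pops_closeTime R H E y hbal hk₀O
    have hHτ : H ≤ τ k := (pops_lt_pushes_of_shedLetter_eq_false R H E y hpopτ).2.1
    have hdτ : isDefect R (τ k) = false := isDefect_eq_false_of_pop R H E y hpopτ
    have hτs : τ k < closeTime R H E y hbal k := closeTime_lt_closeTime R H E y hbal hk₀k hkO
    have hsE : closeTime R H E y hbal k < E := (closeTime_lt_iff R H E y hbal hkO E).2 hkE
    have hτE : τ k < E := hτs.trans hsE
    have hτN : τ k < N := hτE.trans_le hEN
    have hpops_s : pops (shedPrefix R H E y (closeTime R H E y hbal k)) = k := pops_closeTime R H E y hbal hkO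
    have hpop_s : shedLetter R H E y (closeTime R H E y hbal k) = false := shedLetter_closeTime R H E y hbal hkO
    -- `k` is pushed at time `τ k`: the queue holds an S-item other than `k₀ k` right after the pop
    have hkpush : k < pushes (shedPrefix R H E y (τ k)) := by
      have hb := (sContent_mem_band R H E y hEN hw (t := τ k + 1) (by omega) (by omega)
        fun s h1 h2 => hband s h1 (by omega)).1.1
      have hpos : 0 < sContent R H E y (τ k + 1) := by zify; omega
      unfold sContent at hpos
      obtain ⟨i, hi⟩ := card_pos.1 hpos
      rw [mem_filter, mem_Ico, pops_succ_of_pop R H E y hpopτ, hpopsτ, rankO_succ, hpopτ] at hi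
      simp only [Bool.false_eq_true, ↓reduceIte, add_zero] at hi
      obtain ⟨⟨hi1, hi2⟩, hiS⟩ := hi
      by_contra hle
      rw [not_lt] at hle
      have := hbetween i (by omega) (by omega)
      rw [hiS] at this; exact Bool.noConfusion this
    -- the engine at `τ k` with `L := k - k₀ k`, `s := closeTime k`
    have eng := chain R H E y hEN hw hband hHτ hpopτ (L := k - k₀ k)
      (fun l h1 h2 => by rw [hpopsτ]; exact hbetween _ (by omega) (by omega)) hτs hsE
      (isDefect_eq_false_of_pop R H E y hpop_s) (by rw [hpopsτ, hpops_s]; omega)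
    have hfairτ : isFair R H E y (τ k) = true :=
      isFair_of R H E y hEN hw hband hdτ hHτ hτE (by rw [hpopsτ]; exact hk₀S)
    -- the last position of the chain: `q`, where `k` reaches the front
    obtain ⟨hqs, hpopsq, _⟩ := eng (k - k₀ k) le_rfl
    rw [hpopsτ, Nat.add_sub_cancel' hk₀k.le] at hpopsq
    have hqE : freeIter R (τ k) (k - k₀ k) < E := hqs.trans_lt hsE
    have hHq : H ≤ freeIter R (τ k) (k - k₀ k) := by
      have := freeIter_le_freeIter R (t := τ k) (Nat.zero_le (k - k₀ k)); rw [freeIter_zero] at this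
      exact hHτ.trans this
    -- KEY: if `q` is not a test then `τ k` is a gate
    have hkey : isTest R H E y S (freeIter R (τ k) (k - k₀ k)) = false → isGate R H E y S (τ k) = true := by
      intro hnt
      rw [isGate_iff, goodExitL_iff]
      refine ⟨hfairτ, ?_⟩
      have hLm : lookLenL R S (shedPrefix R H E y (τ k)) ≤ k - k₀ k :=
        lookLenL_le_of_isRItem_eq_false R H E y S hτN.le (by omega)
          (by rw [hpopsτ, Nat.add_sub_cancel' hk₀k.le]; exact hkpush)
          (by rw [hpopsτ, Nat.add_sub_cancel' hk₀k.le]; exact hkS')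
      have hpushL : pops (shedPrefix R H E y (τ k)) + lookLenL R S (shedPrefix R H E y (τ k)) <
          pushes (shedPrefix R H E y (τ k)) := by rw [hpopsτ]; omega
      -- colours of the chain positions
      have hcolours : ∀ l, l ≤ k - k₀ k → posColour S (freeIter R (τ k) l) =
          posColour S (openTime R H E y (k₀ k + l)) := by
        intro l hl
        rcases Nat.eq_zero_or_pos l with hl0 | hl0
        · subst hl0
          rw [freeIter_zero, add_zero, posColour_eq_of_pop R H E y S hbal hresp hτN hpopτ, hpopsτ]
        rcases hl.lt_or_eq with hlt | hle
        · obtain ⟨_, hpl, hll⟩ := eng l hl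
          obtain ⟨hls, hpopl⟩ := hll hlt
          rw [posColour_eq_of_pop R H E y S hbal hresp (hls.trans_le (hsE.le.trans hEN) |> fun h =>
            lt_of_lt_of_le hls ((hsE.le.trans hEN))) hpopl, hpl, hpopsτ]
        · subst hle
          rw [Nat.add_sub_cancel' hk₀k.le]
          by_cases hpq : shedLetter R H E y (freeIter R (τ k) (k - k₀ k)) = false
          · rw [posColour_eq_of_pop R H E y S hbal hresp (hqE.trans_le hEN) hpq, hpopsq]
          · have hfq : isFair R H E y (freeIter R (τ k) (k - k₀ k)) = true :=
              isFair_of R H E y hEN hw hband (isDefect_freeIter R hl0) hHq hqE (by rw [hpopsq]; exact hkS')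
            rw [posColour_eq_of_not_isTest R H E y S (hqE.le.trans hEN) hfq hnt, hpopsq]
      refine ⟨hpushL, ?_, ?_, fun l hl => ?_⟩
      · -- the colour change at the look-ahead item
        rcases (lookLenL_spec R S (shedPrefix R H E y (τ k))).2 with h | h | h
        · omega
        · exact h
        · rw [pRL_eq R H E y hτN.le hpushL] at h
          have hLeq : lookLenL R S (shedPrefix R H E y (τ k)) = k - k₀ k := by
            by_contra hne
            have := hbetween (k₀ k + lookLenL R S (shedPrefix R H E y (τ k)))
              (by have := (lookLenL_spec R S (shedPrefix R H E y (τ k))).1; omega) (by omega)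
            rw [hpopsτ] at h; rw [h] at this; exact Bool.noConfusion this
          rw [hLeq, hpopsτ, Nat.add_sub_cancel' hk₀k.le, pcolL_eq R H E y S hτN.le hkpush,
            pcolL_eq R H E y S hτN.le (by omega)]
          exact hcolk
      · exact lt_of_le_of_lt (freeIter_le_freeIter R hLm) hqE
      · rw [hcolours l (hl.trans hLm), pcolL_eq R H E y S hτN.le (by rw [hpopsτ]; omega), hpopsτ]
    refine ⟨?_, ?_, ?_⟩
    · by_cases hgate : isGate R H E y S (τ k) = true
      · right
        have hφk : φ k = τ k := by simp only [hφ]; rw [if_pos hgate]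
        rw [hφk, kind_eq_two_iff]
        refine ⟨⟨isTest_eq_false_of_isGate R H E y S hτN.le hgate, hgate⟩, ?_⟩
        unfold desig
        rw [isTest_eq_false_of_isGate R H E y S hτN.le hgate, ← bit_eq_bitAt, ← shedLetter_of_isFair R H E y hfairτ]
        exact hpopτ
      · left
        have hφk : φ k = freeIter R (τ k) (k - k₀ k) := by simp only [hφ]; rw [if_neg hgate]
        rw [hφk, kind_eq_one_iff]
        by_contra hnt
        rw [Bool.not_eq_true] at hnt
        exact hgate (hkey hnt)
    · by_cases hgate : isGate R H E y S (τ k) = true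
      · simp only [hφ]; rw [if_pos hgate]
      · simp only [hφ]; rw [if_neg hgate]
        have := freeIter_le_freeIter R (t := τ k) (Nat.zero_le (k - k₀ k)); rwa [freeIter_zero] at this
    · by_cases hgate : isGate R H E y S (τ k) = true
      · simp only [hφ]; rw [if_pos hgate]; exact hτs
      · simp only [hφ]; rw [if_neg hgate]
        rcases hqs.lt_or_eq with h | h
        · exact h
        · -- `q = closeTime k` is a pop position, but `q` is a test: the bit is `U`
          exfalso
          have htest : isTest R H E y S (freeIter R (τ k) (k - k₀ k)) = true := by
            by_contra hnt; rw [Bool.not_eq_true] at hnt; exact hgate (hkey hnt)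
          have hU := bit_of_isTest R H E y S hbal hresp (hqE.trans_le hEN) htest
          have hfq : isFair R H E y (freeIter R (τ k) (k - k₀ k)) = true := by
            unfold isTest at htest; rw [Bool.and_eq_true] at htest; exact htest.1
          have hbit : bit y (freeIter R (τ k) (k - k₀ k)) = true := by
            unfold bit; rw [dif_pos (hqE.trans_le hEN)]; exact hU
          have hL := shedLetter_of_isFair R H E y hfq
          rw [hbit, h, hpop_s] at hL
          exact Bool.noConfusion hL
  -- `φ` is strictly increasing on `B₁`, hence injective
  have hmonoφ : ∀ k ∈ B₁, ∀ k' ∈ B₁, k < k' → φ k < φ k' := by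
    intro k hk k' hk' hlt
    obtain ⟨_, _, h1⟩ := hspec k hk
    obtain ⟨_, h2, _⟩ := hspec k' hk'
    refine lt_of_lt_of_le h1 (le_trans ?_ h2)
    -- `closeTime k ≤ closeTime (k₀ k')` since `k ≤ k₀ k'`
    rw [hB₁, mem_filter, hB, mem_filter, mem_Ioo] at hk hk'
    have hkS : (!isRItem R H E y k) = true := hk.1.2.1
    have hkk₀ : k ≤ k₀ k' := Nat.le_findGreatest (P := fun n => (!isRItem R H E y n) = true) (by omega) hkS
    have hk'O : k' < (openerSet (shedWord R H E y)).card := lt_of_lt_of_le hk'.1.1.2 hpopsE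
    have hk₀'k' : k₀ k' < k' := (findGreatest_spec_of_exists R H E y hk'.2).1
    rcases hkk₀.lt_or_eq with h | h
    · exact (closeTime_lt_closeTime R H E y hbal h (hk₀'k'.trans hk'O)).le
    · simp only [hτ]; rw [h]
  have hinj : Set.InjOn φ B₁ := by
    intro k hk k' hk' heq
    by_contra hne
    rcases Nat.lt_or_gt_of_ne hne with h | h
    · exact absurd heq (hmonoφ k hk k' hk' h).ne
    · exact absurd heq.symm (hmonoφ k' hk' k hk h).ne
  -- the image lies in the union of the two coin sets
  have hmaps : ∀ k ∈ B₁, φ k ∈ ((range N).filter fun j => kind R H E S j y = 1) ∪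
      ((range N).filter fun j => kind R H E S j y = 2 ∧ bitAt y j = desig R H E S j y) := by
    intro k hk
    obtain ⟨hkind, _, hlt⟩ := hspec k hk
    rw [hB₁, mem_filter, hB, mem_filter, mem_Ioo] at hk
    have hkO : k < (openerSet (shedWord R H E y)).card := lt_of_lt_of_le hk.1.1.2 hpopsE
    have hφN : φ k < N := hlt.trans (closeTime_lt R H E y hbal hkO)
    rw [mem_union, mem_filter, mem_filter, mem_range]
    rcases hkind with h | h
    · exact Or.inl ⟨hφN, h⟩
    · exact Or.inr ⟨hφN, h⟩
  have hB₁le := (card_le_card_of_injOn φ hmaps hinj).trans (card_union_le _ _)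
  omega

/-! ### The pricing of the respecting band words -/

/-- The test-coin count in the `kind` bookkeeping. [folklore] -/
theorem filter_kind_eq_one (v : Fin N → Bool) :
    ((range N).filter fun j => kind R H E S j v = 1) = (range N).filter fun j => isTest R H E v S j = true := by
  apply filter_congr; intro j _; exact kind_eq_one_iff R H E S j v

/-- **PRICING OF μ* = shedWord.**  Let `A` be a set of band bit strings (`|fairWalk| < w < F₀` on `[H, E]`) whose balanced words
respect `S`, and suppose every `y ∈ A` has `2P + 5 ≤ #tests(y) + sBoundariesPopped(y)`.  Then `#A · (4/3)^P ≤ 2^N`. [folklore] -/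
theorem card_resp_mul_le_of_gates (hEN : E ≤ N) {w : ℕ} (hwF : w < freeCount R 0 H) (A : Finset (Fin N → Bool)) (P : ℕ)
    (hband : ∀ y ∈ A, ∀ s, H ≤ s → s ≤ E → |fairWalk R H E y s| < w)
    (hbal : ∀ y ∈ A, (closerSet (shedWord R H E y)).card = (openerSet (shedWord R H E y)).card)
    (hresp : ∀ y (hy : y ∈ A), ∀ i, i ∈ S ↔ fifo (shedWord R H E y) (hbal y hy) i ∈ S)
    (hP : ∀ y ∈ A, 2 * P + 5 ≤ ((range N).filter fun j => isTest R H E y S j = true).card + sBoundariesPopped R H E y S) :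
    (A.card : ℝ) * (4 / 3 : ℝ) ^ P ≤ 2 ^ N := by
  classical
  refine card_mul_le_of_passages_succ (kind R H E S) (desig R H E S) (kind_eq_of_agree R H E S) A P ?_ ?_ ?_
  · intro v hv j hj h1
    rw [kind_eq_one_iff] at h1
    have := bit_of_isTest R H E v S (hbal v hv) (hresp v hv) hj h1
    unfold desig bitAt
    rw [h1, dif_pos hj, this]
  · intro v hv
    exact card_failedGates_le R H E v S (hbal v hv) (hresp v hv) hEN hwF.le (hband v hv)
  · intro v hv
    have h1 := card_sBoundariesPopped_le R H E v S (hbal v hv) (hresp v hv) hEN hwF (hband v hv)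
    have h2 := hP v hv
    rw [← filter_kind_eq_one] at h2
    omega

end Summit.ValiantsHypothesis.ValiantsHypothesis.Theorems.FifoMatching.NNLinearDegreeCofactorHard.ShedWord

end
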